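import Summits.ResolutionOfSingularities.ResolutionOfSingularities.Theorems.SyzygyFlatteningDefs
import Summits.ResolutionOfSingularities.ResolutionOfSingularities.Theorems.SyzygyFlatteningHigherRankTerminationTowerLocalisation
import Summits.ResolutionOfSingularities.ResolutionOfSingularities.Theorems.SyzygyFlatteningGlobalisationCentreChart
import Summits.ResolutionOfSingularities.ResolutionOfSingularities.Theorems.SyzygyFlatteningGlobalisationNormalizationStage
import Summits.ResolutionOfSingularities.ResolutionOfSingularities.Theorems.SyzygyFlatteningGlobalisationDatumBlowup
import Summits.ResolutionOfSingularities.ResolutionOfSingularities.Theorems.SyzygyFlatteningGlobalisationSyzygyDatumExists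
import Summits.ResolutionOfSingularities.ResolutionOfSingularities.Theorems.SyzygyFlatteningGlobalisationAffineRes
import Summits.ResolutionOfSingularities.ResolutionOfSingularities.Theorems.SyzygyFlatteningGlobalisationSyzygyDatumCompat
import Summits.ResolutionOfSingularities.ResolutionOfSingularities.Theorems.SyzygyFlatteningGlobalisationSyzygyDatumChart
import Summits.ResolutionOfSingularities.ResolutionOfSingularities.Theorems.SyzygyFlatteningGlobalisationDatumBlowupStalk
import Literature.AlgebraicGeometry.Resolution.ProperModels
import Literature.AlgebraicGeometry.Resolution.LocalBlowup
import HarnessLib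

/-!
# `SyzygyFlattening.Globalisation` (crux stmt-ResolutionOfSingularities-17061), line `birth`:
# ONE STEP of the syzygy-flattening operator on proper models

Route `ResolutionOfSingularities/SyzygyFlattening`, crux #4 `Globalisation`. The route's operator on
local rings `B ⊆ K` along a valuation ring `O` is `step O B = locAt O (nrm (chart O B))` (blow up the
ideal of maximal minors of the top syzygy of the non-regular locus, normalise, localise at the centre;
`Theorems/SyzygyFlatteningDefs.lean`). This file PROVES that it is induced by a GLOBAL morphism of proper
models: for every proper model `M` of `K/k` there is `M' → M`, `RegLe`, whose local ring at the centre of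
every valuation ring `v`, realised in `K` through `K(M') ≅ K`, is `step 𝒪_v B` for `B` the local ring of
`M` at the centre of `v` (`globalisation_oneStep`).

Assembly of the landed stubs of the line: a syzygy norm ideal datum on every non-empty affine open
(`stub_syzygyDatumExists`), compatible up to scalars on smaller affine opens (`stub_affineRes`,
`stub_syzygyDatumCompat`), glues to a proper birational blow-up (`stub_datumBlowup`) whose local rings
at centres are the blow-up charts of minimal minors (`stub_datumBlowupStalk`) `= locAt 𝒪_v (chart 𝒪_v B)`
(`stub_syzygyDatumChart`) — `globalisation_syzygyBlowupStage`; then normalise (`stub_normalizationStage`),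
with `stub_nrm_locAt` for the stalk identity and `stub_regularStep` for `RegLe`.

No definitions are introduced.
-/

noncomputable section

-- single-problem summit: the doubled namespace component `ResolutionOfSingularities` is forced
set_option linter.dupNamespace false

namespace Summit.ResolutionOfSingularities.ResolutionOfSingularities.Theorems.SyzygyFlattening

open CategoryTheory AlgebraicGeometry TopologicalSpace
open Literature.AlgebraicGeometry
open Literature.AlgebraicGeometry.Resolution

variable {k K : Type} [Field k] [Field K] [Algebra k K]

/-! ## Local rings of proper models in `K` -/

/-- Every point of a proper model is the centre of some valuation ring of `K/k`. [folklore] -/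
theorem globalisation_exists_eq_centre (M : ProperModel k K) (x : M.X) :
    ∃ v : ZariskiRiemannSpace k K, x = M.centre v := by
  have hgen : IsGenericPoint M.toKModel.genericPt (Set.univ : Set M.X) := by
    rw [M.genericPt_eq']
    exact genericPoint_spec M.X
  obtain ⟨v, hv⟩ := M.toKModel.exists_isCentre_of_isGenericPoint hgen x
  exact ⟨v, ProperModel.eq_centre_of_isCentre hv⟩

/-- Some affine open contains the centre. [folklore] -/
theorem globalisation_exists_isAffineOpen_mem (M : ProperModel k K) (x : M.X) :
    ∃ U : M.X.Opens, IsAffineOpen U ∧ x ∈ U := by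
  obtain ⟨_, ⟨U, hU, rfl⟩, hxU, -⟩ :=
    M.X.isBasis_affineOpens.exists_subset_of_mem_open (Set.mem_univ x) isOpen_univ
  exact ⟨U, hU, hxU⟩

/-- `stub_centreChart` at a centre (any affine chart): injectivity of `𝒪_{M,x} → K` and a finitely generated
chart `A ⊆ 𝒪_v` with `Frac A = K` and `locAt 𝒪_v A` = the local ring in `K`. [folklore] -/
theorem globalisation_exists_chart (M : ProperModel k K) (v : ZariskiRiemannSpace k K) :
    Function.Injective ((M.X.presheaf.stalkSpecializes (genericPoint_specializes (M.centre v)) ≫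
        M.funFieldIso.hom).hom) ∧
      ∃ A : Subalgebra k K, A.FG ∧ IsFractionRing ↥A K ∧
        A.toSubring ≤ v.asValuationSubring.toSubring ∧
        (locAt v.asValuationSubring A).toSubring = ((M.X.presheaf.stalkSpecializes (genericPoint_specializes (M.centre v)) ≫ M.funFieldIso.hom).hom).range := by
  obtain ⟨U, hU, hx⟩ := globalisation_exists_isAffineOpen_mem M (M.centre v)
  obtain ⟨hinj, A, -, hfg, hfr, hle, hloc⟩ := stub_centreChart k K M v U hU hx
  exact ⟨hinj, A, hfg, hfr, hle, hloc⟩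

/-- The local ring at a centre, in `K`, lies in `𝒪_v`. [folklore] -/
theorem globalisation_stalk_range_le (M : ProperModel k K) (v : ZariskiRiemannSpace k K) :
    ((M.X.presheaf.stalkSpecializes (genericPoint_specializes (M.centre v)) ≫ M.funFieldIso.hom).hom).range ≤ v.asValuationSubring.toSubring := by
  obtain ⟨-, A, -, -, hle, hloc⟩ := globalisation_exists_chart M v
  rw [← hloc]
  exact locAt_toSubring_le v.asValuationSubring v.algebraMap_mem hle

/-- A subalgebra whose underlying subring is the local ring at `x` in `K` is ring-isomorphic to the
stalk `𝒪_{M,x}` (injectivity of `𝒪_{M,x} → K`). [folklore] -/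
theorem globalisation_nonempty_ringEquiv_stalk (M : ProperModel k K) (x : M.X)
    (hinj : Function.Injective ((M.X.presheaf.stalkSpecializes (genericPoint_specializes x) ≫
        M.funFieldIso.hom).hom))
    (B : Subalgebra k K) (hB : B.toSubring = ((M.X.presheaf.stalkSpecializes (genericPoint_specializes x) ≫ M.funFieldIso.hom).hom).range) :
    Nonempty (↥B ≃+* M.X.presheaf.stalk x) := by
  set f := (M.X.presheaf.stalkSpecializes (genericPoint_specializes x) ≫ M.funFieldIso.hom).hom
  have hbij : Function.Bijective f.rangeRestrict :=
    ⟨fun a b h => hinj (congrArg Subtype.val h), f.rangeRestrict_surjective⟩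
  let e₁ : M.X.presheaf.stalk x ≃+* f.range := RingEquiv.ofBijective f.rangeRestrict hbij
  have hB' : ∀ y : K, y ∈ B ↔ y ∈ f.range := fun y => by
    change y ∈ B.toSubring ↔ _
    rw [hB]
  let e₂ : ↥B ≃+* f.range :=
    { toFun := fun y => ⟨y.1, (hB' y.1).mp y.2⟩
      invFun := fun y => ⟨y.1, (hB' y.1).mpr y.2⟩
      left_inv := fun _ => rfl
      right_inv := fun _ => rfl
      map_mul' := fun _ _ => rfl
      map_add' := fun _ _ => rfl }
  exact ⟨e₂.trans e₁.symm⟩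

/-- `Frac B = K` for any `k`-subalgebra `B` of `K` containing one with `Frac = K`. [folklore] -/
theorem globalisation_isFractionRing_of_le {A B : Subalgebra k K} (hAB : A ≤ B) [hA : IsFractionRing ↥A K] :
    IsFractionRing ↥B K := by
  refine IsFractionRing.of_field (↥B) K fun z => ?_
  obtain ⟨a, b, -, rfl⟩ := IsFractionRing.div_surjective (A := ↥A) z
  exact ⟨⟨(a : K), hAB a.2⟩, ⟨(b : K), hAB b.2⟩, rfl⟩

/-! ## The syzygy blow-up stage -/

/-- A non-zero ideal of the sections of an affine chart containing the centre of `v` has a non-zero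
element of minimal `v`-value (finite generation + `exists_max_valuation` on generators; values of
sections at the centre are `≤ 1`). [folklore] -/
theorem globalisation_exists_minimal_mem (M : ProperModel k K) (v : ZariskiRiemannSpace k K) {U : M.X.Opens}
    (hU : IsAffineOpen U) (hx : M.centre v ∈ U) (N : Ideal Γ(M.X, U)) (hN : N ≠ ⊥) :
    ∃ u₀ ∈ N, u₀ ≠ 0 ∧ ∀ n ∈ N,
      v.asValuationSubring.valuation
          ((((M.X.presheaf.stalkSpecializes (genericPoint_specializes (M.centre v)) ≫
            M.funFieldIso.hom).hom).comp (M.X.presheaf.germ U (M.centre v) hx).hom) n) ≤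
        v.asValuationSubring.valuation
          ((((M.X.presheaf.stalkSpecializes (genericPoint_specializes (M.centre v)) ≫
            M.funFieldIso.hom).hom).comp (M.X.presheaf.germ U (M.centre v) hx).hom) u₀) := by
  classical
  let sec : Γ(M.X, U) →+* K :=
    ((M.X.presheaf.stalkSpecializes (genericPoint_specializes (M.centre v)) ≫
      M.funFieldIso.hom).hom).comp (M.X.presheaf.germ U (M.centre v) hx).hom
  let O := v.asValuationSubring
  show ∃ u₀ ∈ N, u₀ ≠ 0 ∧ ∀ n ∈ N, O.valuation (sec n) ≤ O.valuation (sec u₀)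
  -- sections have values `≤ 1`
  obtain ⟨-, A, hA, -, -, hAO, -⟩ := stub_centreChart k K M v U hU hx
  have hsecO : ∀ a : Γ(M.X, U), sec a ∈ O := fun a =>
    hAO (show sec a ∈ A from by rw [← SetLike.mem_coe, hA]; exact ⟨a, rfl⟩)
  have hle1 : ∀ a : Γ(M.X, U), O.valuation (sec a) ≤ 1 := fun a =>
    (O.valuation_le_one_iff _).mpr (hsecO a)
  -- a finite generating set with a non-zero member
  haveI : IsNoetherianRing Γ(M.X, U) :=
    IsLocallyNoetherian.component_noetherian (⟨U, hU⟩ : M.X.affineOpens)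
  obtain ⟨t, ht⟩ := (IsNoetherian.noetherian N : N.FG)
  have hne : ∃ g ∈ t, sec g ≠ 0 := by
    by_contra! hcon
    apply hN
    rw [← ht, Ideal.span_eq_bot]
    intro g hg
    have hinj : Function.Injective sec := by
      change Function.Injective ((((M.X.presheaf.stalkSpecializes
        (genericPoint_specializes (M.centre v)) ≫ M.funFieldIso.hom).hom)) ∘
        (M.X.presheaf.germ U (M.centre v) hx).hom)
      exact (centreChart_stalkToK_injective M (M.centre v)).comp
        (AlgebraicGeometry.germ_injective_of_isIntegral M.X (M.centre v) hx)
    exact hinj (by rw [hcon g hg, map_zero])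
  obtain ⟨u₀, hu₀t, hu₀0, hmax⟩ := exists_max_valuation O t (fun g => sec g) hne
  refine ⟨u₀, ht ▸ Ideal.subset_span hu₀t, fun h => hu₀0 (by rw [h, map_zero]), ?_⟩
  intro n hn
  rw [← ht] at hn
  refine Submodule.span_induction (p := fun n _ => O.valuation (sec n) ≤ O.valuation (sec u₀))
    ?_ ?_ ?_ ?_ hn
  · exact fun g hg => hmax g hg
  · simp
  · intro x y _ _ hx' hy'
    rw [map_add]
    exact Valuation.map_add_le _ hx' hy'
  · intro c x _ hx'
    rw [smul_eq_mul, map_mul, map_mul]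
    calc O.valuation (sec c) * O.valuation (sec x)
        ≤ 1 * O.valuation (sec u₀) := mul_le_mul' (hle1 c) hx'
      _ = O.valuation (sec u₀) := one_mul _

/-- **The syzygy blow-up stage** (the v2 skeleton's load-bearing stub, now a theorem): choose a syzygy norm ideal datum on every non-empty affine open
(`stub_syzygyDatumExists`); they are compatible up to scalars (`stub_affineRes` + `stub_syzygyDatumCompat`),
so they glue to a proper birational `π : Y → M` (`stub_datumBlowup`) and a proper model `M₁ → M`
whose local ring at the centre of `v` is `locAt 𝒪_v (A[N_U/u₀])` (`stub_datumBlowupStalk`)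
`= locAt 𝒪_v (chart 𝒪_v B)` (`stub_syzygyDatumChart`). [cite: Villamayoru2006, Thm. 3.3 and 3.4] -/
theorem globalisation_syzygyBlowupStage (M : ProperModel k K) :
    ∃ (M₁ : ProperModel k K) (_ : M₁.Hom M),
      ∀ (v : ZariskiRiemannSpace k K) (B : Subalgebra k K),
        B.toSubring = ((M.X.presheaf.stalkSpecializes (genericPoint_specializes (M.centre v)) ≫
            M.funFieldIso.hom).hom).range →
        (locAt v.asValuationSubring (chart v.asValuationSubring B)).toSubring =
          ((M₁.X.presheaf.stalkSpecializes (genericPoint_specializes (M₁.centre v)) ≫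
            M₁.funFieldIso.hom).hom).range := by
  classical
  -- the ideal of the non-regular locus and the datum property, by affine open
  let J : ∀ U : M.X.affineOpens, Ideal Γ(M.X, U) := fun U =>
    sInf ((fun 𝔭 : PrimeSpectrum Γ(M.X, U) => 𝔭.asIdeal) ''
      {𝔭 : PrimeSpectrum Γ(M.X, U) | ¬ IsRegularLocalRing (Localization.AtPrime 𝔭.asIdeal)})
  let P : ∀ U : M.X.affineOpens, Ideal Γ(M.X, U) → Prop := fun U N =>
    ∃ (F : FreeResolution Γ(M.X, U) (Γ(M.X, U) ⧸ J U)) (r : ℕ)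
      (φ : ↥(F.syzygy (syzygyIndex k K - 1)) →ₗ[Γ(M.X, U)] (Fin r → Γ(M.X, U))),
      Function.Injective φ ∧ IsFraming φ ∧ N = normIdeal φ
  have hex : ∀ U : M.X.affineOpens, ((U : M.X.Opens) : Set M.X).Nonempty →
      ∃ N : Ideal Γ(M.X, U), N ≠ ⊥ ∧ P U N :=
    fun U hU => stub_syzygyDatumExists k K M U U.2 hU
  -- the datum (and `⊥` on empty affine opens)
  let N : ∀ U : M.X.affineOpens, Ideal Γ(M.X, U) := fun U =>
    if hU : ((U : M.X.Opens) : Set M.X).Nonempty then (hex U hU).choose else ⊥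
  have hN : ∀ (U : M.X.affineOpens) (hU : ((U : M.X.Opens) : Set M.X).Nonempty),
      N U ≠ ⊥ ∧ P U (N U) := by
    intro U hU
    have : N U = (hex U hU).choose := dif_pos hU
    rw [this]
    exact (hex U hU).choose_spec
  have h0 : ∀ U : M.X.affineOpens, ((U : M.X.Opens) : Set M.X).Nonempty → N U ≠ ⊥ :=
    fun U hU => (hN U hU).1
  -- compatibility up to scalars on smaller affine opens
  have hc : ∀ (U V : M.X.affineOpens) (hVU : (V : M.X.Opens) ≤ (U : M.X.Opens)),
      ((V : M.X.Opens) : Set M.X).Nonempty →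
      ∃ a b : Γ(M.X, V), a ≠ 0 ∧ b ≠ 0 ∧
        Ideal.span {a} * N V =
          Ideal.span {b} * (N U).map (M.X.presheaf.map (homOfLE hVU).op).hom := by
    intro U V hVU hV
    have hU' : ((U : M.X.Opens) : Set M.X).Nonempty := hV.mono hVU
    obtain ⟨hinj, hflat, hJ⟩ := stub_affineRes k K M U V U.2 V.2 hVU hV
    obtain ⟨-, hPU⟩ := hN U hU'
    obtain ⟨-, hPV⟩ := hN V hV
    haveI : Nonempty (V : M.X.Opens) := ⟨⟨_, hV.some_mem⟩⟩
    haveI : Nonempty (U : M.X.Opens) := ⟨⟨_, hU'.some_mem⟩⟩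
    haveI : IsNoetherianRing Γ(M.X, U) := IsLocallyNoetherian.component_noetherian U
    haveI : IsNoetherianRing Γ(M.X, V) := IsLocallyNoetherian.component_noetherian V
    have hPV' : ∃ (F' : FreeResolution Γ(M.X, V) (Γ(M.X, V) ⧸ (J U).map
        (M.X.presheaf.map (homOfLE hVU).op).hom)) (r' : ℕ)
        (φ' : ↥(F'.syzygy (syzygyIndex k K - 1)) →ₗ[Γ(M.X, V)] (Fin r' → Γ(M.X, V))),
        Function.Injective φ' ∧ IsFraming φ' ∧ N V = normIdeal φ' := by
      have hJ' : J V = (J U).map (M.X.presheaf.map (homOfLE hVU).op).hom := hJ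
      rw [← hJ']
      exact hPV
    exact stub_syzygyDatumCompat Γ(M.X, U) Γ(M.X, V) (M.X.presheaf.map (homOfLE hVU).op).hom
      hinj hflat (J U) (syzygyIndex k K - 1) (N U) (N V) hPU hPV'
  -- glue, package, and read off the local rings at centres
  obtain ⟨Y, π, hY, hπ, hblow⟩ := stub_datumBlowup k K M N h0 hc
  obtain ⟨M₁, φ₁, hst⟩ := stub_datumBlowupStalk k K M N Y π hY hπ h0 hblow
  refine ⟨M₁, φ₁, fun v B hB => ?_⟩
  obtain ⟨_, ⟨U, hU, rfl⟩, hxU, -⟩ :=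
    M.X.isBasis_affineOpens.exists_subset_of_mem_open (Set.mem_univ (M.centre v)) isOpen_univ
  have hUne : ((U : M.X.Opens) : Set M.X).Nonempty := ⟨_, hxU⟩
  obtain ⟨hNU, hPU⟩ := hN ⟨U, hU⟩ hUne
  obtain ⟨u₀, hu₀N, hu₀0, hmin⟩ := globalisation_exists_minimal_mem M v hU hxU (N ⟨U, hU⟩) hNU
  have e1 := stub_syzygyDatumChart k K M v U hU hxU B hB (N ⟨U, hU⟩) hPU u₀ hu₀N hu₀0 hmin
  have e2 := hst v U hU hxU u₀ hu₀N hu₀0 hmin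
  rw [e1]
  exact e2.symm

/-! ## One step -/

/-- **ONE STEP of Φ on proper models** (from `globalisation_syzygyBlowupStage`,
`stub_normalizationStage`, `stub_centreChart` and the landed local algebra): for every proper model `M` there is `M' → M`, `RegLe`,
whose local ring at the centre of every `v`, in `K`, is `step 𝒪_v B` for `B` the local ring of `M` at the
centre of `v`. The stalk identity: `step 𝒪_v B = locAt (nrm (chart B)) = locAt (nrm (locAt (chart B)))`
(`stub_nrm_locAt`) and the two stages compute `locAt (chart B)` resp. `locAt (nrm ·)`. `RegLe`: a point
`y` over a regular `x` is the centre of some `w`; the local ring `B` of `x` is regular, so `step 𝒪_w B = B`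
(`stub_regularStep`), i.e. `𝒪_{M',y} ≅ B ≅ 𝒪_{M,x}` is regular.
[cite: Villamayor2006Flattening, Thm. 1.1 (flattening by blowing up)] -/
theorem globalisation_oneStep (M : ProperModel k K) :
    ∃ (M' : ProperModel k K) (φ : M'.Hom M), φ.RegLe ∧
      ∀ (v : ZariskiRiemannSpace k K) (B : Subalgebra k K),
        B.toSubring =
          ((M.X.presheaf.stalkSpecializes (genericPoint_specializes (M.centre v)) ≫ M.funFieldIso.hom).hom).range →
        (step v.asValuationSubring B).toSubring =
          ((M'.X.presheaf.stalkSpecializes (genericPoint_specializes (M'.centre v)) ≫ M'.funFieldIso.hom).hom).range := by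
  obtain ⟨M₁, φ₁, hM₁⟩ := globalisation_syzygyBlowupStage M
  obtain ⟨M₂, φ₂, hM₂⟩ := stub_normalizationStage stub_centreChart k K M₁
  have hstalk : ∀ (v : ZariskiRiemannSpace k K) (B : Subalgebra k K),
      B.toSubring =
        ((M.X.presheaf.stalkSpecializes (genericPoint_specializes (M.centre v)) ≫ M.funFieldIso.hom).hom).range →
      (step v.asValuationSubring B).toSubring =
        ((M₂.X.presheaf.stalkSpecializes (genericPoint_specializes (M₂.centre v)) ≫ M₂.funFieldIso.hom).hom).range := by
    intro v B hB
    set O := v.asValuationSubring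
    have hk : ∀ c : k, algebraMap k K c ∈ O := v.algebraMap_mem
    have hBO : B.toSubring ≤ O.toSubring := by rw [hB]; exact globalisation_stalk_range_le M v
    have hCO : (chart O B).toSubring ≤ O.toSubring := chart_toSubring_le O hk hBO
    have e₁ := hM₁ v B hB
    have e₂ := hM₂ v (locAt O (chart O B)) e₁
    rw [step_def, ← stub_nrm_locAt k K O (chart O B) hk hCO]
    exact e₂
  refine ⟨M₂, φ₂.comp φ₁, ?_, hstalk⟩
  -- `RegLe`
  intro y hreg
  obtain ⟨w, rfl⟩ := globalisation_exists_eq_centre M₂ y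
  have hx : (φ₂.comp φ₁).f (M₂.centre w) = M.centre w := ProperModel.Hom.map_centre _ w
  rw [hx] at hreg
  set O := w.asValuationSubring
  obtain ⟨hinjM, A, -, hfr, hAO, hloc⟩ := globalisation_exists_chart M w
  set B : Subalgebra k K := locAt O A
  have hk : ∀ c : k, algebraMap k K c ∈ O := w.algebraMap_mem
  have hBO : B.toSubring ≤ O.toSubring := locAt_toSubring_le O hk hAO
  haveI : IsFractionRing ↥B K := globalisation_isFractionRing_of_le (self_le_locAt O A)
  obtain ⟨eB⟩ := globalisation_nonempty_ringEquiv_stalk M (M.centre w) hinjM B hloc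
  haveI : IsRegularLocalRing ↥B := by
    haveI := hreg
    exact IsRegularLocalRing.of_ringEquiv eB.symm
  have hfix : step O B = B :=
    stub_regularStep k K O B hk hBO ‹_› (locAt_locAt O A hAO) ‹_›
  have hst : (step O B).toSubring =
      ((M₂.X.presheaf.stalkSpecializes (genericPoint_specializes (M₂.centre w)) ≫ M₂.funFieldIso.hom).hom).range := hstalk w B hloc
  rw [hfix] at hst
  obtain ⟨hinj₂, -⟩ := globalisation_exists_chart M₂ w
  obtain ⟨e₂⟩ := globalisation_nonempty_ringEquiv_stalk M₂ (M₂.centre w) hinj₂ B hst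
  exact IsRegularLocalRing.of_ringEquiv (eB.symm.trans e₂)

end Summit.ResolutionOfSingularities.ResolutionOfSingularities.Theorems.SyzygyFlattening

end
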